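import Summits.CriticalPhenomena.PercolationContinuityZ3.Theorems.PercNearOneGluingNoHeavyQuantKnShiftNumericGeneric
import Mathlib.Analysis.Complex.ExponentialBounds
import HarnessLib

/-!
# QUANT lane, PAPER-2 track (i) ARM-2 (constants bookkeeper), gen 8: the DKT threshold `n₁(d, δ)` at the WIDE window `δ = 1/(2d)`
# — kernel numerals `2^4768 ≤ dktN1 3 (1/6) ≤ 2^4800` (vs `dktN1 3 (1/64) ∈ [2^259056, 2^259880]`), and `d = 4, 5, 6`

builds on p205010 (kernel theorem, internal audit signed; external expert review pending)

Cell `prim-quant`, seat `prim-quant-arm-2` (explicit constants of the rate chain); memo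
`run/shared/lean/prim/quant/prim-quant-arm-2/RATE-CONSTANTS.md` §5 (power-law row) / §8 (lever "DKT window δ: 1/64 → 1/(2d)").

WHY.  The CONDITIONAL power-law row of ARM-1 gen 8 (`Quant.oneArmPolyDecayAtCritical_of_ballTwoPoint`,
`…QuantTwoPointPowerLaw.lean`, RATE-PLAN §17.2: a power saving `Σ_{Λ_R} τ_{p_c} ≤ C R^{d−a}` gives
`π_{p_c}(n) ≤ (3(N₁+1))^c √(C+1) · n^{−c}`, `c = dktAlpha d · min(a,1)/2`) carries the DKT threshold `N₁ = dktN1 d δ` IN THE PREFACTOR,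
through the window constant `δ` of Duminil-Copin–Kozma–Tassion's Proposition 1 (valid uniformly on `p ∈ [δ, 1−δ]`; Cerf's two-arms
constant has the factor `exp((2d+½)²/(8δ²(1−δ)²))`).  The lane's generic choice `δ = critDelta d = min(1/(2d), 1/64) = 1/64` makes
`log₂ N₁(3) ≈ 2.6·10⁵` (prefactor `≈ 2^590` at `d = 3`); since `1/(2d) ≤ p_c(ℤ^d) ≤ 1/2 ≤ 1 − 1/(2d)` (tree: Grimmett (1.13) +
Kesten via `Quant.criticalProbI_le_one_sub_inv_two_mul`), the window `δ = 1/(2d)` is admissible and gives `log₂ N₁(3) ≈ 4.8·10³`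
(prefactor `2^11`).  This file is the NUMERAL half of that lever (pure arithmetic on the closed forms of
`Literature/…/CerfUniquenessZoneBoundExplicit.lean`; nothing probabilistic):

* §1 `exp` versus powers of two with the convergents `13/9` and `36/25` of `log₂ e` (`Quant.exp_le_two_pow_of_le`:
  `13x ≤ 9m ⇒ exp x ≤ 2^m`; `Quant.two_pow_le_exp_of_le`: `25m ≤ 36x ⇒ 2^m ≤ exp x`) — they replace the lane's `exp n ≤ 4^n`
  (which cost 39 % of every exponent) at a total slack below 2 bits;
* §2 a δ-GENERIC two-sided numeral pipeline `aknKappa_le/ge_of_window`, `dktK_le/ge_of_window` (the factor `18` of `n₁ = ⌈(18K)^8⌉` folded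
  in, `7/5 ≤ √2 ≤ 99/70`), `dktN1_le/ge_of_window` — every `d`- and `δ`-dependent numeral a hypothesis discharged by `norm_num`;
* §3 instances: **`2^4768 ≤ dktN1 3 (1/6) ≤ 2^4800`** (true value `2^4784.6`), `2^11224 ≤ dktN1 4 (1/8) ≤ 2^11272`,
  `2^23216 ≤ dktN1 5 (1/10) ≤ 2^23296`, `2^43456 ≤ dktN1 6 (1/12) ≤ 2^43600`, and the OLD window sharpened:
  **`2^259056 ≤ dktN1 3 (1/64) ≤ 2^259880`** (true `2^259553.9`; the tree had `[2^178592, 2^359128]`, p211861 / KnFirstScale).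
Second derivation of every numeral (exact rationals): `run/shared/lean/prim/quant/prim-quant-arm-2-g8/code/dkt_window_cert.py`.
Class of the unconditional rate (log*) and the honest sentence UNCHANGED — these numbers enter only the CONDITIONAL power-law row.
[cite: DuminilcopinKozmaTassion2020, Proposition 1 and §7] [cite: Cerf2015, Prop 5.2]
-/

noncomputable section

namespace Summit.CriticalPhenomena.PercolationContinuityZ3.Theorems.Quant

open Literature.Probability.Percolation Literature.Probability.LatticeModels
open Literature.Probability.Percolation.AKN
open PowTwo

variable {d : ℕ}

/-! ### §1. `exp` against powers of two: `e⁹ ≤ 2¹³` and `2³⁶ ≤ e²⁵` -/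

/-- `exp 9 ≤ 2^13` (`e⁹ = 8103.08…`, from `exp 1 < 2.7182818286`). [folklore] (numeric) -/
theorem exp_nine_le_two_pow : Real.exp 9 ≤ (2 : ℝ) ^ 13 := by
  have h := Real.exp_one_lt_d9
  have h0 : 0 ≤ Real.exp 1 := (Real.exp_pos 1).le
  have h9 : Real.exp 9 = Real.exp 1 ^ 9 := by rw [Real.exp_one_pow]; norm_num
  calc Real.exp 9 = Real.exp 1 ^ 9 := h9
    _ ≤ (2.7182818286 : ℝ) ^ 9 := pow_le_pow_left₀ h0 h.le 9
    _ ≤ 2 ^ 13 := by norm_num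

/-- **`13 x ≤ 9 m ⇒ exp x ≤ 2^m`** (`13/9 = 1.444…` is a convergent of `log₂ e = 1.4427…` from above; slack `0.0018` bits per nat).
[folklore] (numeric) -/
theorem exp_le_two_pow_of_le {x : ℝ} {m : ℕ} (h : 13 * x ≤ 9 * m) : Real.exp x ≤ (2 : ℝ) ^ m := by
  have h1 : x ≤ 9 * ((m : ℝ) / 13) := by linarith
  calc Real.exp x ≤ Real.exp (9 * ((m : ℝ) / 13)) := Real.exp_le_exp.2 h1
    _ = Real.exp 9 ^ ((m : ℝ) / 13) := by rw [Real.exp_mul]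
    _ ≤ ((2 : ℝ) ^ (13 : ℕ)) ^ ((m : ℝ) / 13) :=
        Real.rpow_le_rpow (Real.exp_pos _).le exp_nine_le_two_pow (by positivity)
    _ = (2 : ℝ) ^ m := by
        rw [← Real.rpow_natCast (2 : ℝ) 13, ← Real.rpow_mul (by norm_num : (0 : ℝ) ≤ 2),
          show ((13 : ℕ) : ℝ) * ((m : ℝ) / 13) = ((m : ℕ) : ℝ) by push_cast; ring, Real.rpow_natCast]

/-- `2^36 ≤ exp 25` (`e²⁵ = 7.2·10¹⁰ ≥ 6.87·10¹⁰`, from `2.7182818283 < exp 1`). [folklore] (numeric) -/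
theorem two_pow_le_exp_twentyfive : (2 : ℝ) ^ 36 ≤ Real.exp 25 := by
  have h := Real.exp_one_gt_d9
  have h25 : Real.exp 1 ^ 25 = Real.exp 25 := by rw [Real.exp_one_pow]; norm_num
  calc (2 : ℝ) ^ 36 ≤ (2.7182818283 : ℝ) ^ 25 := by norm_num
    _ ≤ Real.exp 1 ^ 25 := pow_le_pow_left₀ (by norm_num) h.le 25
    _ = Real.exp 25 := h25

/-- **`25 m ≤ 36 x ⇒ 2^m ≤ exp x`** (`36/25 = 1.44` below `log₂ e`; slack `0.0027` bits per nat). [folklore] (numeric) -/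
theorem two_pow_le_exp_of_le {x : ℝ} {m : ℕ} (h : 25 * (m : ℝ) ≤ 36 * x) : (2 : ℝ) ^ m ≤ Real.exp x := by
  have h1 : 25 * ((m : ℝ) / 36) ≤ x := by linarith
  calc (2 : ℝ) ^ m = ((2 : ℝ) ^ (36 : ℕ)) ^ ((m : ℝ) / 36) := by
        rw [← Real.rpow_natCast (2 : ℝ) 36, ← Real.rpow_mul (by norm_num : (0 : ℝ) ≤ 2),
          show ((36 : ℕ) : ℝ) * ((m : ℝ) / 36) = ((m : ℕ) : ℝ) by push_cast; ring, Real.rpow_natCast]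
    _ ≤ (Real.exp 25) ^ ((m : ℝ) / 36) := Real.rpow_le_rpow (by positivity) two_pow_le_exp_twentyfive (by positivity)
    _ = Real.exp (25 * ((m : ℝ) / 36)) := (Real.exp_mul _ _).symm
    _ ≤ Real.exp x := Real.exp_le_exp.2 h1

/-- `a √y ≤ 2^k` from `a² y ≤ 2^(2k)` (`a, y ≥ 0`). [folklore] -/
theorem PowTwo.mul_sqrt_le (k : ℕ) {a y : ℝ} (ha : 0 ≤ a) (h : a ^ 2 * y ≤ (2 : ℝ) ^ (2 * k)) :
    a * Real.sqrt y = a * Real.sqrt y ∧ a * Real.sqrt y ≤ (2 : ℝ) ^ k := by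
  refine ⟨rfl, ?_⟩
  have : a * Real.sqrt y = Real.sqrt (a ^ 2 * y) := by
    rw [Real.sqrt_mul (sq_nonneg a), Real.sqrt_sq ha]
  rw [this]
  exact PowTwo.sqrt_le k h

/-! ### §2. The δ-generic two-sided numeral pipeline for `aknKappa`, `18·dktK`, `dktN1` (`0 < δ ≤ 1/2`) -/

/-- **Generic `aknKappa d δ ≤ 2^m`**: the exponential factor via `exp_le_two_pow_of_le` (hypothesis `13·E_{d,δ} ≤ 9e`,
`E_{d,δ} = (2d+½)²/(4·2δ²(1−δ)²)`), the prefactor `3^d·16d²/δ ≤ 2^{a₁}`, the middle term `3^d √(8d²3^{d−1}) ≤ 2^{a₂}`.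
[cite: Cerf2015, Prop 5.2] -/
theorem aknKappa_le_of_window (d : ℕ) {δ : ℝ} (hδ0 : 0 < δ) {e a₁ a₂ m : ℕ}
    (hE : 13 * ((2 * (d : ℝ) + 1 / 2) ^ 2 / (4 * (2 * δ ^ 2 * (1 - δ) ^ 2))) ≤ 9 * e)
    (hpre : (3 : ℝ) ^ d * (16 * (d : ℝ) ^ 2 / δ) ≤ (2 : ℝ) ^ a₁)
    (hsq : ((3 : ℝ) ^ d) ^ 2 * (8 * (d : ℝ) ^ 2 * 3 ^ (d - 1)) ≤ (2 : ℝ) ^ (2 * a₂))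
    (h1 : a₁ + e ≤ m) (h2 : a₂ ≤ m) (h3 : 2 ≤ m) :
    aknKappa d δ ≤ (2 : ℝ) ^ m := by
  have hexp : Real.exp ((2 * (d : ℝ) + 1 / 2) ^ 2 / (4 * (2 * δ ^ 2 * (1 - δ) ^ 2))) ≤ (2 : ℝ) ^ e :=
    exp_le_two_pow_of_le hE
  have hmid : (3 : ℝ) ^ d * Real.sqrt (8 * (d : ℝ) ^ 2 * 3 ^ (d - 1)) ≤ (2 : ℝ) ^ a₂ :=
    (PowTwo.mul_sqrt_le a₂ (by positivity) hsq).2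
  unfold aknKappa
  refine max_le (rle_of m (k := 2) (by norm_num) h3) (max_le (rle_of m hmid h2) ?_)
  exact rmul_le m hpre hexp (by positivity) (Real.exp_pos _).le h1

/-- **Generic `2^m ≤ aknKappa d δ`** (lower side): `2^e ≤ exp E_{d,δ}` from `25e ≤ 36 E_{d,δ}` and `2^p ≤ 3^d·16d²/δ`.
[cite: Cerf2015, Prop 5.2] -/
theorem aknKappa_ge_of_window (d : ℕ) {δ : ℝ} {e p m : ℕ}
    (hE : 25 * (e : ℝ) ≤ 36 * ((2 * (d : ℝ) + 1 / 2) ^ 2 / (4 * (2 * δ ^ 2 * (1 - δ) ^ 2))))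
    (hpre : (2 : ℝ) ^ p ≤ (3 : ℝ) ^ d * (16 * (d : ℝ) ^ 2 / δ)) (h : m ≤ p + e) :
    (2 : ℝ) ^ m ≤ aknKappa d δ := by
  have hexp : (2 : ℝ) ^ e ≤ Real.exp ((2 * (d : ℝ) + 1 / 2) ^ 2 / (4 * (2 * δ ^ 2 * (1 - δ) ^ 2))) :=
    two_pow_le_exp_of_le hE
  unfold aknKappa
  refine le_trans ?_ (le_max_right _ _)
  refine le_trans ?_ (le_max_right _ _)
  calc (2 : ℝ) ^ m ≤ (2 : ℝ) ^ (p + e) := pow_le_pow_right₀ (by norm_num) h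
    _ = (2 : ℝ) ^ p * (2 : ℝ) ^ e := pow_add _ _ _
    _ ≤ (3 : ℝ) ^ d * (16 * (d : ℝ) ^ 2 / δ) *
          Real.exp ((2 * (d : ℝ) + 1 / 2) ^ 2 / (4 * (2 * δ ^ 2 * (1 - δ) ^ 2))) :=
        mul_le_mul hpre hexp (by positivity) ((pow_nonneg (by norm_num) p).trans hpre)

/-- The numeral factor of `18·dktK d δ` with `√2` replaced by a rational `s`:
`C(d, δ, s) = 18·(1+2d)(2d)^{2d}/δ^{2d+3}·7^{4d²+4d}·(d·s)·2^{2d}`. (Local abbreviation used only in statements below.) [folklore] -/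
theorem dktK_eighteen_mul_eq (d : ℕ) {δ : ℝ} (hδ : δ ≤ 1 / 2) :
    18 * dktK d δ =
      (18 * ((1 + 2 * (d : ℝ)) * (2 * (d : ℝ)) ^ (2 * d) / δ ^ (2 * d + 3) * 7 ^ (4 * d ^ 2 + 4 * d : ℕ) *
        ((d : ℝ) * Real.sqrt 2) * 2 ^ (2 * d))) * aknKappa d δ := by
  unfold dktK
  rw [min_eq_left hδ]
  ring

/-- **Generic `18·dktK d δ ≤ 2^m`** (`0 < δ ≤ 1/2`) from `aknKappa d δ ≤ 2^{κb}` and the numeral bound on the remaining factors with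
`√2 ≤ 99/70`. [cite: DuminilcopinKozmaTassion2020, §7] -/
theorem dktK_le_of_window (d : ℕ) {δ : ℝ} (hδ0 : 0 < δ) (hδ : δ ≤ 1 / 2) {κb c m : ℕ}
    (hκ : aknKappa d δ ≤ (2 : ℝ) ^ κb)
    (hC : 18 * ((1 + 2 * (d : ℝ)) * (2 * (d : ℝ)) ^ (2 * d) / δ ^ (2 * d + 3) * 7 ^ (4 * d ^ 2 + 4 * d : ℕ) *
        ((d : ℝ) * (99 / 70)) * 2 ^ (2 * d)) ≤ (2 : ℝ) ^ c)
    (h : c + κb ≤ m) : 18 * dktK d δ ≤ (2 : ℝ) ^ m := by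
  have hκ0 : 0 ≤ aknKappa d δ := le_trans (by norm_num) (three_le_aknKappa d _)
  have hs2 : Real.sqrt 2 ≤ 99 / 70 :=
    (Real.sqrt_le_sqrt (by norm_num : (2 : ℝ) ≤ (99 / 70) ^ 2)).trans (by rw [Real.sqrt_sq (by norm_num)])
  have hs0 : 0 ≤ Real.sqrt 2 := Real.sqrt_nonneg 2
  rw [dktK_eighteen_mul_eq d hδ]
  refine rmul_le m (a := c) (b := κb) (hC.trans' ?_) hκ ?_ hκ0 h
  · gcongr
  · positivity

/-- **Generic `2^m ≤ 18·dktK d δ`** (`0 < δ ≤ 1/2`; lower side, `7/5 ≤ √2`). [cite: DuminilcopinKozmaTassion2020, §7] -/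
theorem dktK_ge_of_window (d : ℕ) {δ : ℝ} (hδ0 : 0 < δ) (hδ : δ ≤ 1 / 2) {κb c m : ℕ}
    (hκ : (2 : ℝ) ^ κb ≤ aknKappa d δ)
    (hC : (2 : ℝ) ^ c ≤ 18 * ((1 + 2 * (d : ℝ)) * (2 * (d : ℝ)) ^ (2 * d) / δ ^ (2 * d + 3) * 7 ^ (4 * d ^ 2 + 4 * d : ℕ) *
        ((d : ℝ) * (7 / 5)) * 2 ^ (2 * d)))
    (h : m ≤ c + κb) : (2 : ℝ) ^ m ≤ 18 * dktK d δ := by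
  have hs2 : (7 / 5 : ℝ) ≤ Real.sqrt 2 := Real.le_sqrt_of_sq_le (by norm_num)
  rw [dktK_eighteen_mul_eq d hδ]
  calc (2 : ℝ) ^ m ≤ (2 : ℝ) ^ (c + κb) := pow_le_pow_right₀ (by norm_num) h
    _ = (2 : ℝ) ^ c * (2 : ℝ) ^ κb := pow_add _ _ _
    _ ≤ 18 * ((1 + 2 * (d : ℝ)) * (2 * (d : ℝ)) ^ (2 * d) / δ ^ (2 * d + 3) * 7 ^ (4 * d ^ 2 + 4 * d : ℕ) *
          ((d : ℝ) * (7 / 5)) * 2 ^ (2 * d)) * aknKappa d δ :=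
        mul_le_mul hC hκ (by positivity) (by positivity)
    _ ≤ _ := by
        refine mul_le_mul_of_nonneg_right ?_ (le_trans (by norm_num) (three_le_aknKappa d _))
        gcongr

/-- **Generic `dktN1 d δ ≤ 2^m`** from `18·dktK d δ ≤ 2^k`, `8k ≤ m`, `7 ≤ m` (`n₁ = max(81, ⌈(18K)^8⌉)`).
[cite: DuminilcopinKozmaTassion2020, Proposition 1] -/
theorem dktN1_le_of_window (d : ℕ) {δ : ℝ} (hδ0 : 0 < δ) {k m : ℕ} (hK : 18 * dktK d δ ≤ (2 : ℝ) ^ k)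
    (h : 8 * k ≤ m) (hm : 7 ≤ m) : dktN1 d δ ≤ 2 ^ m := by
  have hK0 : 0 ≤ 18 * dktK d δ := by
    unfold dktK
    have := three_le_aknKappa d (min δ (1 / 2))
    have : 0 < min δ (1 / 2) := lt_min hδ0 (by norm_num)
    positivity
  have h8 : (18 * dktK d δ) ^ 8 ≤ (2 : ℝ) ^ m := rpow_le m 8 hK hK0 (by omega)
  unfold dktN1
  exact max_le_iff.2 ⟨le_of m (k := 7) (by norm_num) hm, ceil_le m h8⟩

/-- **Generic `2^m ≤ dktN1 d δ`** from `2^k ≤ 18·dktK d δ`, `m ≤ 8k`. [cite: DuminilcopinKozmaTassion2020, Proposition 1] -/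
theorem dktN1_ge_of_window (d : ℕ) (δ : ℝ) {k m : ℕ} (hK : (2 : ℝ) ^ k ≤ 18 * dktK d δ) (h : m ≤ 8 * k) :
    2 ^ m ≤ dktN1 d δ := by
  unfold dktN1
  refine le_max_of_le_right ?_
  have h0 : (0 : ℝ) ≤ 2 ^ k := pow_nonneg (by norm_num) _
  have hreal : ((2 ^ m : ℕ) : ℝ) ≤ (18 * dktK d δ) ^ 8 := by
    calc ((2 ^ m : ℕ) : ℝ) = (2 : ℝ) ^ m := by rw [Nat.cast_pow, Nat.cast_ofNat]
      _ ≤ (2 : ℝ) ^ (8 * k) := pow_le_pow_right₀ (by norm_num) h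
      _ = ((2 : ℝ) ^ k) ^ 8 := by rw [← pow_mul, mul_comm]
      _ ≤ (18 * dktK d δ) ^ 8 := pow_le_pow_left₀ h0 hK 8
  calc 2 ^ m = ⌈((2 ^ m : ℕ) : ℝ)⌉₊ := (Nat.ceil_natCast _).symm
    _ ≤ ⌈(18 * dktK d δ) ^ 8⌉₊ := Nat.ceil_mono hreal

/-! ### §3. Instances: the wide window `δ = 1/(2d)`, `d = 3, 4, 5, 6`, and the old window `δ = 1/64` at `d = 3` sharpened -/

/-- `aknKappa 3 (1/6) ≤ 2^411` (`E = 273.78` nats: `13E ≤ 9·396`; `27·864 ≤ 2^15`; `27√648 ≤ 2^10`; true `2^409.49`). [cite: Cerf2015, Prop 5.2] -/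
theorem aknKappa_three_sixth_le : aknKappa 3 (1 / 6) ≤ (2 : ℝ) ^ 411 :=
  aknKappa_le_of_window 3 (by norm_num) (e := 396) (a₁ := 15) (a₂ := 10) (by norm_num) (by norm_num) (by norm_num)
    (by norm_num) (by norm_num) (by norm_num)

/-- `2^408 ≤ aknKappa 3 (1/6)` (`25·394 ≤ 36E`, `2^14 ≤ 23328`). [cite: Cerf2015, Prop 5.2] -/
theorem aknKappa_three_sixth_ge : (2 : ℝ) ^ 408 ≤ aknKappa 3 (1 / 6) :=
  aknKappa_ge_of_window 3 (e := 394) (p := 14) (by norm_num) (by norm_num) (by norm_num)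

/-- `18·dktK 3 (1/6) ≤ 2^600` (numeral factor `≤ 2^189`; true `2^598.08`). [cite: DuminilcopinKozmaTassion2020, §7] -/
theorem dktK_three_sixth_le : 18 * dktK 3 (1 / 6) ≤ (2 : ℝ) ^ 600 :=
  dktK_le_of_window 3 (by norm_num) (by norm_num) (c := 189) aknKappa_three_sixth_le (by norm_num) (by norm_num)

/-- `2^596 ≤ 18·dktK 3 (1/6)` (numeral factor `≥ 2^188`). [cite: DuminilcopinKozmaTassion2020, §7] -/
theorem dktK_three_sixth_ge : (2 : ℝ) ^ 596 ≤ 18 * dktK 3 (1 / 6) :=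
  dktK_ge_of_window 3 (by norm_num) (by norm_num) (c := 188) aknKappa_three_sixth_ge (by norm_num) (by norm_num)

/-- **`dktN1 3 (1/6) ≤ 2^4800`** — the DKT threshold at `p_c(ℤ³)` with the wide window `[1/6, 5/6] ∋ p_c` (true value `2^4784.6`;
compare `dktN1 3 (1/64) ≥ 2^259056`). [cite: DuminilcopinKozmaTassion2020, Proposition 1 and §7] -/
theorem dktN1_three_sixth_le : dktN1 3 (1 / 6) ≤ 2 ^ 4800 :=
  dktN1_le_of_window 3 (by norm_num) dktK_three_sixth_le (by norm_num) (by norm_num)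

/-- **`2^4768 ≤ dktN1 3 (1/6)`** (two-sided: `log₂ dktN1 3 (1/6) ∈ [4768, 4800]`). [cite: DuminilcopinKozmaTassion2020, Proposition 1 and §7] -/
theorem dktN1_three_sixth_ge : 2 ^ 4768 ≤ dktN1 3 (1 / 6) :=
  dktN1_ge_of_window 3 (1 / 6) dktK_three_sixth_ge (by norm_num)

set_option exponentiation.threshold 5000 in
/-- `aknKappa 4 (1/8) ≤ 2^1109`, `18·dktK 4 (1/8) ≤ 2^1409`, hence **`dktN1 4 (1/8) ≤ 2^11272`** (true `2^11247.3`).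
[cite: DuminilcopinKozmaTassion2020, Proposition 1 and §7] [cite: Cerf2015, Prop 5.2] -/
theorem dktN1_four_eighth_le : dktN1 4 (1 / 8) ≤ 2 ^ 11272 := by
  have hκ : aknKappa 4 (1 / 8) ≤ (2 : ℝ) ^ 1109 :=
    aknKappa_le_of_window 4 (by norm_num) (e := 1091) (a₁ := 18) (a₂ := 13) (by norm_num) (by norm_num) (by norm_num)
      (by norm_num) (by norm_num) (by norm_num)
  have hK : 18 * dktK 4 (1 / 8) ≤ (2 : ℝ) ^ 1409 :=
    dktK_le_of_window 4 (by norm_num) (by norm_num) (c := 300) hκ (by norm_num) (by norm_num)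
  exact dktN1_le_of_window 4 (by norm_num) hK (by norm_num) (by norm_num)

set_option exponentiation.threshold 5000 in
/-- **`2^11224 ≤ dktN1 4 (1/8)`**. [cite: DuminilcopinKozmaTassion2020, Proposition 1 and §7] -/
theorem dktN1_four_eighth_ge : 2 ^ 11224 ≤ dktN1 4 (1 / 8) := by
  have hκ : (2 : ℝ) ^ 1104 ≤ aknKappa 4 (1 / 8) :=
    aknKappa_ge_of_window 4 (e := 1087) (p := 17) (by norm_num) (by norm_num) (by norm_num)
  have hK : (2 : ℝ) ^ 1403 ≤ 18 * dktK 4 (1 / 8) :=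
    dktK_ge_of_window 4 (by norm_num) (by norm_num) (c := 299) hκ (by norm_num) (by norm_num)
  exact dktN1_ge_of_window 4 (1 / 8) hK (by norm_num)

set_option exponentiation.threshold 5000 in
/-- `aknKappa 5 (1/10) ≤ 2^2478`, `18·dktK 5 (1/10) ≤ 2^2912`, hence **`dktN1 5 (1/10) ≤ 2^23296`** (true `2^23265.7`).
[cite: DuminilcopinKozmaTassion2020, Proposition 1 and §7] [cite: Cerf2015, Prop 5.2] -/
theorem dktN1_five_tenth_le : dktN1 5 (1 / 10) ≤ 2 ^ 23296 := by
  have hκ : aknKappa 5 (1 / 10) ≤ (2 : ℝ) ^ 2478 :=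
    aknKappa_le_of_window 5 (by norm_num) (e := 2458) (a₁ := 20) (a₂ := 15) (by norm_num) (by norm_num) (by norm_num)
      (by norm_num) (by norm_num) (by norm_num)
  have hK : 18 * dktK 5 (1 / 10) ≤ (2 : ℝ) ^ 2912 :=
    dktK_le_of_window 5 (by norm_num) (by norm_num) (c := 434) hκ (by norm_num) (by norm_num)
  exact dktN1_le_of_window 5 (by norm_num) hK (by norm_num) (by norm_num)

set_option exponentiation.threshold 5000 in
/-- **`2^23216 ≤ dktN1 5 (1/10)`**. [cite: DuminilcopinKozmaTassion2020, Proposition 1 and §7] -/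
theorem dktN1_five_tenth_ge : 2 ^ 23216 ≤ dktN1 5 (1 / 10) := by
  have hκ : (2 : ℝ) ^ 2469 ≤ aknKappa 5 (1 / 10) :=
    aknKappa_ge_of_window 5 (e := 2450) (p := 19) (by norm_num) (by norm_num) (by norm_num)
  have hK : (2 : ℝ) ^ 2902 ≤ 18 * dktK 5 (1 / 10) :=
    dktK_ge_of_window 5 (by norm_num) (by norm_num) (c := 433) hκ (by norm_num) (by norm_num)
  exact dktN1_ge_of_window 5 (1 / 10) hK (by norm_num)

set_option exponentiation.threshold 5000 in
/-- `aknKappa 6 (1/12) ≤ 2^4858`, `18·dktK 6 (1/12) ≤ 2^5450`, hence **`dktN1 6 (1/12) ≤ 2^43600`** (true `2^43540.0`).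
[cite: DuminilcopinKozmaTassion2020, Proposition 1 and §7] [cite: Cerf2015, Prop 5.2] -/
theorem dktN1_six_twelfth_le : dktN1 6 (1 / 12) ≤ 2 ^ 43600 := by
  have hκ : aknKappa 6 (1 / 12) ≤ (2 : ℝ) ^ 4858 :=
    aknKappa_le_of_window 6 (by norm_num) (e := 4835) (a₁ := 23) (a₂ := 18) (by norm_num) (by norm_num) (by norm_num)
      (by norm_num) (by norm_num) (by norm_num)
  have hK : 18 * dktK 6 (1 / 12) ≤ (2 : ℝ) ^ 5450 :=
    dktK_le_of_window 6 (by norm_num) (by norm_num) (c := 592) hκ (by norm_num) (by norm_num)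
  exact dktN1_le_of_window 6 (by norm_num) hK (by norm_num) (by norm_num)

set_option exponentiation.threshold 5000 in
/-- **`2^43456 ≤ dktN1 6 (1/12)`**. [cite: DuminilcopinKozmaTassion2020, Proposition 1 and §7] -/
theorem dktN1_six_twelfth_ge : 2 ^ 43456 ≤ dktN1 6 (1 / 12) := by
  have hκ : (2 : ℝ) ^ 4841 ≤ aknKappa 6 (1 / 12) :=
    aknKappa_ge_of_window 6 (e := 4819) (p := 22) (by norm_num) (by norm_num) (by norm_num)
  have hK : (2 : ℝ) ^ 5432 ≤ 18 * dktK 6 (1 / 12) :=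
    dktK_ge_of_window 6 (by norm_num) (by norm_num) (c := 591) hκ (by norm_num) (by norm_num)
  exact dktN1_ge_of_window 6 (1 / 12) hK (by norm_num)

/-- The OLD window sharpened: `aknKappa 3 (1/64) ≤ 2^32265`, `18·dktK 3 (1/64) ≤ 2^32485`, hence **`dktN1 3 (1/64) ≤ 2^259880`**
(true `2^259553.9`; the tree's `dktN1_three_le` (p211861) has `2^359128` via `exp n ≤ 4^n`).
[cite: DuminilcopinKozmaTassion2020, Proposition 1 and §7] [cite: Cerf2015, Prop 5.2] -/
theorem dktN1_three_le_sharp : dktN1 3 (1 / 64) ≤ 2 ^ 259880 := by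
  have hκ : aknKappa 3 (1 / 64) ≤ (2 : ℝ) ^ 32265 :=
    aknKappa_le_of_window 3 (by norm_num) (e := 32247) (a₁ := 18) (a₂ := 10) (by norm_num) (by norm_num) (by norm_num)
      (by norm_num) (by norm_num) (by norm_num)
  have hK : 18 * dktK 3 (1 / 64) ≤ (2 : ℝ) ^ 32485 :=
    dktK_le_of_window 3 (by norm_num) (by norm_num) (c := 220) hκ (by norm_num) (by norm_num)
  exact dktN1_le_of_window 3 (by norm_num) hK (by norm_num) (by norm_num)

/-- The OLD window sharpened, lower side: **`2^259056 ≤ dktN1 3 (1/64)`** (the tree's `dktN1_three_ge` has `2^178592` via `exp 1 ≥ 2`).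
[cite: DuminilcopinKozmaTassion2020, Proposition 1 and §7] [cite: Cerf2015, Prop 5.2] -/
theorem dktN1_three_ge_sharp : 2 ^ 259056 ≤ dktN1 3 (1 / 64) := by
  have hκ : (2 : ℝ) ^ 32163 ≤ aknKappa 3 (1 / 64) :=
    aknKappa_ge_of_window 3 (e := 32146) (p := 17) (by norm_num) (by norm_num) (by norm_num)
  have hK : (2 : ℝ) ^ 32382 ≤ 18 * dktK 3 (1 / 64) :=
    dktK_ge_of_window 3 (by norm_num) (by norm_num) (c := 219) hκ (by norm_num) (by norm_num)
  exact dktN1_ge_of_window 3 (1 / 64) hK (by norm_num)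

set_option exponentiation.threshold 300000 in
/-- `(2^4800)^53 < 2^259056` (`4800·53 = 254400`; the option lets the elaborator normalise the literal powers). [folklore] (numeric) -/
theorem two_pow_pow_lt_aux : (2 ^ 4800) ^ 53 < 2 ^ 259056 :=
  calc (2 ^ 4800) ^ 53 = 2 ^ (4800 * 53) := (pow_mul 2 4800 53).symm
    _ < 2 ^ 259056 := Nat.pow_lt_pow_right Nat.one_lt_two (by decide)

/-- **At `d = 3` the wide window divides the bit-length of the DKT threshold by more than 50**:
`(dktN1 3 (1/6))^53 < dktN1 3 (1/64)` (`53·4800 = 254400 < 259056`). [cite: DuminilcopinKozmaTassion2020, Proposition 1 and §7] -/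
theorem dktN1_three_sixth_pow_lt : dktN1 3 (1 / 6) ^ 53 < dktN1 3 (1 / 64) :=
  lt_of_le_of_lt (Nat.pow_le_pow_left dktN1_three_sixth_le 53)
    (two_pow_pow_lt_aux.trans_le dktN1_three_ge_sharp)

end Summit.CriticalPhenomena.PercolationContinuityZ3.Theorems.Quant

end
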